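import Literature.Probability.RandomPlanarGeometry.SAWSubBallisticEightDirPrelim
import Literature.Probability.RandomPlanarGeometry.SAWTiltedFiniteMemory16D7x6
import Mathlib.Analysis.Complex.Exponential
import HarnessLib

/-!
# Duminil-Copin–Hammond's sub-ballisticity on `ℤ²` with an explicit rate above speed `0.415` (eight directions)

Topic `Literature/Probability/RandomPlanarGeometry` (continues `SAWSubBallisticMaxDisplacement.lean`,
which covers the Euclidean excursion `‖ω_k‖ ≥ vn` by the four AXIS events at level `vn/√2` and so
needs `v > √2·v₀ = 0.5414`). Covering instead by EIGHT directions (`SAWSubBallisticEightDirPrelim.lean`: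
axis events at level `0.9238·vn`, diagonal events `±x ± y ≥ 1.3065·vn`, the latter certified by the
DIAGONALLY tilted memory-16 automaton `FiniteMemory.checkD_16_7_6`, `λ̄ = 2.830067…`) lowers the
threshold to `v₁ = max(0.4144, 0.4134) = 0.4144`:

* `card_maxDisplacementEvent_le_eight` — `#E ≤ 4·#(axis event) + 4·#(diagonal event)`;
* **`card_maxDisplacementEvent_le_of_checkW_checkD`** (any axis + diagonal certificate, any certified
  `μlo ≤ μ`) and **`card_maxDisplacementEvent_le_exp8`**: for all `v ≥ 0`, `n`,
  `#(maxDisplacementEvent 2 n v) ≤ 4(n+1)2⁸² (e^{-ε₁(v) n} + e^{-ε₂(v) n}) cₙ`,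
  `ε₁(v) = 0.9238·v·log(11/9) - log(2.8119181/2.604)`, `ε₂(v) = 1.3065·v·log(7/6) - log(2.8300670/2.604)`;
* `speedThreshold8` (`= 0.41438…`) and **`dch_thm11_two_explicit`** — THE PRINTED SHAPE: for every
  `v > speedThreshold8` there are `ε > 0`, `n₀` (explicit in the proof: `ε = min(ε₁,ε₂)/2`,
  `n₀ = ⌈2⁸⁸/ε²⌉ + 2`) with `#{γ ∈ SAW_n : max_k ‖γ_k‖ ≥ vn}/cₙ ≤ e^{-εn}` for all `n ≥ n₀` — i.e.
  `Zd.DuminilCopinHammond2013_thm1_1` for `d = 2` restricted to `v > 0.4144`, now a theorem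
  (with the printed `μ ≥ 2.625622` the same argument gives `v > 0.372`).

## References

* H. Duminil-Copin, A. Hammond, *Self-avoiding walk is sub-ballistic*, Commun. Math. Phys. 324
  (2013) 401–423, Theorem 1.1 (arXiv:1205.0401) [DuminilCopinHammond2013].
* A. Pönitz, P. Tittmann, Electron. J. Combin. 7 (2000) R21, §3 [PonitzTittmann2000].
-/

open Finset Literature.Probability.LatticeModels
open scoped BigOperators

namespace Literature.Probability.RandomPlanarGeometry.SAW

open FiniteMemory

/-! ### The Duminil-Copin–Hammond event through eight directions -/

/-- **Eight-direction covering of the event**: for `v ≥ 0`,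
`#(maxDisplacementEvent 2 n v) ≤ 4·#{∃ k ≤ n : x(ω_k) ≥ ⌈0.9238 vn⌉} + 4·#{∃ k ≤ n : x(ω_k)+y(ω_k) ≥ ⌈1.3065 vn⌉}`
(the other six directional events are no larger, by the lattice symmetries).
[cite: DuminilCopinHammond2013, Thm 1.1] -/
theorem card_maxDisplacementEvent_le_eight {v : ℝ} (hv : 0 ≤ v) (n : ℕ) :
    (Zd.maxDisplacementEvent 2 n v).card ≤
      4 * ((sawWords n).filter fun w => ∃ k ≤ n, ⌈9238 / 10000 * (v * n)⌉ ≤ traj w k 0).card +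
      4 * ((sawWords n).filter fun w => ∃ k ≤ n, ⌈13065 / 10000 * (v * n)⌉ ≤ traj w k 0 + traj w k 1).card := by
  classical
  set ma : ℤ := ⌈9238 / 10000 * (v * n)⌉ with hma
  set md : ℤ := ⌈13065 / 10000 * (v * n)⌉ with hmd
  have hword : (Zd.maxDisplacementEvent 2 n v).card =
      ((sawWords n).filter fun w => ∃ k ≤ n, v * n ≤ Zd.euclidNorm (traj w k)).card := by
    rw [Zd.maxDisplacementEvent, ← image_traj_sawWords, filter_image, card_image_of_injOn]
    · intro w hw w' hw' h
      simp only [coe_filter, Set.mem_setOf_eq, mem_sawWords] at hw hw'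
      exact eq_of_traj_eq (by rw [hw.1.1, hw'.1.1]) h
  rw [hword]
  set Ax := (sawWords n).filter fun w => ∃ k ≤ n, ma ≤ traj w k 0 with hAx
  set Anx := (sawWords n).filter fun w => ∃ k ≤ n, ma ≤ negX (traj w k) 0 with hAnx
  set Ay := (sawWords n).filter fun w => ∃ k ≤ n, ma ≤ rotYX (traj w k) 0 with hAy
  set Any := (sawWords n).filter fun w => ∃ k ≤ n, ma ≤ rotNegYX (traj w k) 0 with hAny
  set Dp := (sawWords n).filter fun w => ∃ k ≤ n, md ≤ traj w k 0 + traj w k 1 with hDp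
  set Dm := (sawWords n).filter fun w => ∃ k ≤ n, md ≤ negXY (traj w k) 0 + negXY (traj w k) 1 with hDm
  set Dq := (sawWords n).filter fun w => ∃ k ≤ n, md ≤ negY (traj w k) 0 + negY (traj w k) 1 with hDq
  set Dr := (sawWords n).filter fun w => ∃ k ≤ n, md ≤ negX (traj w k) 0 + negX (traj w k) 1 with hDr
  have hsub : ((sawWords n).filter fun w => ∃ k ≤ n, v * n ≤ Zd.euclidNorm (traj w k)) ⊆
      (Ax ∪ Anx ∪ Ay ∪ Any) ∪ (Dp ∪ Dm ∪ Dq ∪ Dr) := by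
    intro w hw
    rw [mem_filter] at hw
    obtain ⟨hws, k, hk, hkv⟩ := hw
    have hvn : 0 ≤ v * n := by positivity
    simp only [mem_union, hAx, hAnx, hAy, hAny, hDp, hDm, hDq, hDr, mem_filter, negX, negY, negXY,
      rotYX, rotNegYX, Matrix.cons_val_zero, Matrix.cons_val_one]
    rcases exists_dir8_ge_of_euclidNorm_ge hvn hkv with (h0 | h0 | h0 | h0) | (h0 | h0 | h0 | h0)
    · exact Or.inl (Or.inl (Or.inl (Or.inl ⟨hws, k, hk, Int.ceil_le.2 h0⟩)))
    · exact Or.inl (Or.inl (Or.inl (Or.inr ⟨hws, k, hk, Int.ceil_le.2 (by push_cast; exact h0)⟩)))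
    · exact Or.inl (Or.inl (Or.inr ⟨hws, k, hk, Int.ceil_le.2 h0⟩))
    · exact Or.inl (Or.inr ⟨hws, k, hk, Int.ceil_le.2 (by push_cast; exact h0)⟩)
    · exact Or.inr (Or.inl (Or.inl (Or.inl ⟨hws, k, hk, Int.ceil_le.2 (by push_cast; exact h0)⟩)))
    · exact Or.inr (Or.inl (Or.inl (Or.inr ⟨hws, k, hk, Int.ceil_le.2 (by push_cast; linarith)⟩)))
    · exact Or.inr (Or.inl (Or.inr ⟨hws, k, hk, Int.ceil_le.2 (by push_cast; linarith)⟩))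
    · exact Or.inr (Or.inr ⟨hws, k, hk, Int.ceil_le.2 (by push_cast; linarith)⟩)
  obtain ⟨n0, n1, n2, n3⟩ := negX_spec'
  obtain ⟨r0, r1, r2, r3⟩ := rotYX_spec'
  obtain ⟨s0, s1, s2, s3⟩ := rotNegYX_spec'
  obtain ⟨y0, y1, y2, y3⟩ := negY_spec
  obtain ⟨z0, z1, z2, z3⟩ := negXY_spec
  have h1 : Anx.card ≤ Ax.card := card_dirEvent_le _ negX n0 n1 n2 n3 (refl_injective' 2) (fun z => z 0) n ma
  have h2 : Ay.card ≤ Ax.card := card_dirEvent_le _ rotYX r0 r1 r2 r3 (rot_injective' 3) (fun z => z 0) n ma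
  have h3 : Any.card ≤ Ax.card := card_dirEvent_le _ rotNegYX s0 s1 s2 s3 (rot_injective' 1) (fun z => z 0) n ma
  have h4 : Dm.card ≤ Dp.card :=
    card_dirEvent_le _ negXY z0 z1 z2 z3 (rot_injective' 2) (fun z => z 0 + z 1) n md
  have h5 : Dq.card ≤ Dp.card :=
    card_dirEvent_le _ negY y0 y1 y2 y3 (refl_injective' 0) (fun z => z 0 + z 1) n md
  have h6 : Dr.card ≤ Dp.card :=
    card_dirEvent_le _ negX n0 n1 n2 n3 (refl_injective' 2) (fun z => z 0 + z 1) n md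
  have u0 := card_le_card hsub
  have u1 := card_union_le (Ax ∪ Anx ∪ Ay ∪ Any) (Dp ∪ Dm ∪ Dq ∪ Dr)
  have u2 := card_union_le (Ax ∪ Anx ∪ Ay) Any
  have u3 := card_union_le (Ax ∪ Anx) Ay
  have u4 := card_union_le Ax Anx
  have u5 := card_union_le (Dp ∪ Dm ∪ Dq) Dr
  have u6 := card_union_le (Dp ∪ Dm) Dq
  have u7 := card_union_le Dp Dm
  omega

/-- **Explicit sub-ballisticity via eight directions.** From an axis-tilted certificate
`(a, b, N, D)` and a diagonally tilted one `(a', b', N', D')` (both with `λ̄ ≥ 2.689`) and a certified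
`0 < μlo ≤ μ(ℤ²)`: for every `v ≥ 0` and `n`, `#(maxDisplacementEvent 2 n v) ≤
4(n+1)2⁸² (e^{-ε₁ n} + e^{-ε₂ n}) cₙ` with `ε₁ = 0.9238 v log(a/b) - log(N/(Dab μlo))` and
`ε₂ = 1.3065 v log(a'/b') - log(N'/(D'a'b' μlo))`. [cite: DuminilCopinHammond2013, Thm 1.1] -/
theorem card_maxDisplacementEvent_le_of_checkW_checkD {K a b N D iters K' a' b' N' D' iters' : ℕ}
    (h : checkW K a b N D iters = true) (hb : 0 < b) (hba : b < a) (hD : 0 < D)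
    (hbig : (2689 / 1000 : ℝ) ≤ (N : ℝ) / (D * a * b))
    (h' : checkD K' a' b' N' D' iters' = true) (hb' : 0 < b') (hba' : b' < a') (hD' : 0 < D')
    (hbig' : (2689 / 1000 : ℝ) ≤ (N' : ℝ) / (D' * a' * b'))
    {μlo : ℝ} (hμ0 : 0 < μlo) (hμ : μlo ≤ Zd.connectiveConstant 2) {v : ℝ} (hv : 0 ≤ v) (n : ℕ) :
    ((Zd.maxDisplacementEvent 2 n v).card : ℝ) ≤
      4 * (n + 1) * 2 ^ 82 *
        (Real.exp (-((9238 / 10000 * v * Real.log ((a : ℝ) / b) - Real.log ((N : ℝ) / (D * a * b) / μlo)) * n)) +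
         Real.exp (-((13065 / 10000 * v * Real.log ((a' : ℝ) / b') -
           Real.log ((N' : ℝ) / (D' * a' * b') / μlo)) * n))) * Zd.count 2 n := by
  have ha : 0 < a := lt_trans hb hba
  have ha' : 0 < a' := lt_trans hb' hba'
  have hs0 : (0 : ℝ) < (b : ℝ) / a := by positivity
  have hs1 : (b : ℝ) / a ≤ 1 := by rw [div_le_one (by exact_mod_cast ha)]; exact_mod_cast hba.le
  have hs0' : (0 : ℝ) < (b' : ℝ) / a' := by positivity
  have hs1' : (b' : ℝ) / a' ≤ 1 := by rw [div_le_one (by exact_mod_cast ha')]; exact_mod_cast hba'.le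
  have hl0 : (0 : ℝ) < (N : ℝ) / (D * a * b) := lt_of_lt_of_le (by norm_num) hbig
  have hl0' : (0 : ℝ) < (N' : ℝ) / (D' * a' * b') := lt_of_lt_of_le (by norm_num) hbig'
  set ma : ℤ := ⌈9238 / 10000 * (v * n)⌉ with hma
  set md : ℤ := ⌈13065 / 10000 * (v * n)⌉ with hmd
  have h8 := card_maxDisplacementEvent_le_eight hv n
  have hA := card_maxEvent_le_of_checkW h hb hba hD hbig n ma
  have hDg := card_maxEventDiag_le_of_checkD h' hb' hba' hD' hbig' n md
  have hμn : μlo ^ n ≤ (Zd.count 2 n : ℝ) :=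
    le_trans (pow_le_pow_left₀ hμ0.le hμ n) (Zd.pow_connectiveConstant_le_count 2 n)
  have hcnt : (0 : ℝ) ≤ Zd.count 2 n := Nat.cast_nonneg _
  -- the two exponential rewritings
  have e1 : ((N : ℝ) / (D * a * b)) ^ n * ((b : ℝ) / a) ^ ma ≤
      Real.exp (-((9238 / 10000 * v * Real.log ((a : ℝ) / b) - Real.log ((N : ℝ) / (D * a * b) / μlo)) * n)) *
        μlo ^ n := by
    have h1 : ((b : ℝ) / a) ^ ma ≤ ((b : ℝ) / a) ^ (9238 / 10000 * v * n : ℝ) := by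
      rw [← Real.rpow_intCast]
      refine Real.rpow_le_rpow_of_exponent_ge hs0 hs1 ?_
      rw [hma, show (9238 : ℝ) / 10000 * v * n = 9238 / 10000 * (v * n) by ring]; exact Int.le_ceil _
    have hexp : ((N : ℝ) / (D * a * b)) ^ n * ((b : ℝ) / a) ^ (9238 / 10000 * v * n : ℝ) =
        Real.exp (-((9238 / 10000 * v * Real.log ((a : ℝ) / b) - Real.log ((N : ℝ) / (D * a * b) / μlo)) * n)) *
          μlo ^ n := by
      rw [Real.rpow_def_of_pos hs0, ← Real.exp_log (pow_pos hl0 n), ← Real.exp_log (pow_pos hμ0 n),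
        ← Real.exp_add, ← Real.exp_add, Real.log_pow, Real.log_pow, Real.log_div hl0.ne' hμ0.ne',
        show Real.log ((b : ℝ) / a) = -Real.log ((a : ℝ) / b) by rw [← Real.log_inv, inv_div]]
      congr 1; ring
    rw [← hexp]; gcongr
  have e2 : ((N' : ℝ) / (D' * a' * b')) ^ n * ((b' : ℝ) / a') ^ md ≤
      Real.exp (-((13065 / 10000 * v * Real.log ((a' : ℝ) / b') -
        Real.log ((N' : ℝ) / (D' * a' * b') / μlo)) * n)) * μlo ^ n := by
    have h1 : ((b' : ℝ) / a') ^ md ≤ ((b' : ℝ) / a') ^ (13065 / 10000 * v * n : ℝ) := by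
      rw [← Real.rpow_intCast]
      refine Real.rpow_le_rpow_of_exponent_ge hs0' hs1' ?_
      rw [hmd, show (13065 : ℝ) / 10000 * v * n = 13065 / 10000 * (v * n) by ring]; exact Int.le_ceil _
    have hexp : ((N' : ℝ) / (D' * a' * b')) ^ n * ((b' : ℝ) / a') ^ (13065 / 10000 * v * n : ℝ) =
        Real.exp (-((13065 / 10000 * v * Real.log ((a' : ℝ) / b') -
          Real.log ((N' : ℝ) / (D' * a' * b') / μlo)) * n)) * μlo ^ n := by
      rw [Real.rpow_def_of_pos hs0', ← Real.exp_log (pow_pos hl0' n), ← Real.exp_log (pow_pos hμ0 n),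
        ← Real.exp_add, ← Real.exp_add, Real.log_pow, Real.log_pow, Real.log_div hl0'.ne' hμ0.ne',
        show Real.log ((b' : ℝ) / a') = -Real.log ((a' : ℝ) / b') by rw [← Real.log_inv, inv_div]]
      congr 1; ring
    rw [← hexp]; gcongr
  set E1 := Real.exp (-((9238 / 10000 * v * Real.log ((a : ℝ) / b) - Real.log ((N : ℝ) / (D * a * b) / μlo)) * n))
  set E2 := Real.exp (-((13065 / 10000 * v * Real.log ((a' : ℝ) / b') -
    Real.log ((N' : ℝ) / (D' * a' * b') / μlo)) * n))
  have hE1 : 0 ≤ E1 := Real.exp_nonneg _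
  have hE2 : 0 ≤ E2 := Real.exp_nonneg _
  calc ((Zd.maxDisplacementEvent 2 n v).card : ℝ)
      ≤ 4 * (((sawWords n).filter fun w => ∃ k ≤ n, ma ≤ traj w k 0).card : ℝ) +
        4 * (((sawWords n).filter fun w => ∃ k ≤ n, md ≤ traj w k 0 + traj w k 1).card : ℝ) := by
          exact_mod_cast h8
    _ ≤ 4 * ((n + 1) * 2 ^ 82 * ((N : ℝ) / (D * a * b)) ^ n * ((b : ℝ) / a) ^ ma) +
        4 * ((n + 1) * 2 ^ 82 * ((N' : ℝ) / (D' * a' * b')) ^ n * ((b' : ℝ) / a') ^ md) := by gcongr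
    _ = 4 * (n + 1) * 2 ^ 82 * ((((N : ℝ) / (D * a * b)) ^ n * ((b : ℝ) / a) ^ ma) +
        (((N' : ℝ) / (D' * a' * b')) ^ n * ((b' : ℝ) / a') ^ md)) := by ring
    _ ≤ 4 * (n + 1) * 2 ^ 82 * (E1 * μlo ^ n + E2 * μlo ^ n) := by gcongr
    _ = 4 * (n + 1) * 2 ^ 82 * (E1 + E2) * μlo ^ n := by ring
    _ ≤ 4 * (n + 1) * 2 ^ 82 * (E1 + E2) * Zd.count 2 n := by gcongr

end Literature.Probability.RandomPlanarGeometry.SAW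
namespace Literature.Probability.RandomPlanarGeometry.SAW

open FiniteMemory

/-- **Duminil-Copin–Hammond's Theorem 1.1 on `ℤ²` with an explicit rate for every `v > 0.4144`**
(axis tilt `11/9`, diagonal tilt `7/6`, memory 16, `μ ≥ 2.604`): for all `v ≥ 0` and `n`,
`#(maxDisplacementEvent 2 n v) ≤ 4(n+1)·2⁸²·(e^{-ε₁ n} + e^{-ε₂ n})·cₙ`,
`ε₁ = 0.9238 v log(11/9) - log(λ̄₁/2.604)`, `ε₂ = 1.3065 v log(7/6) - log(λ̄₂/2.604)`,
`λ̄₁ = 278379899/(10⁶·99)`, `λ̄₂ = 118862805/(10⁶·42)`. [cite: DuminilCopinHammond2013, Thm 1.1] -/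
theorem card_maxDisplacementEvent_le_exp8 {v : ℝ} (hv : 0 ≤ v) (n : ℕ) :
    ((Zd.maxDisplacementEvent 2 n v).card : ℝ) ≤
      4 * (n + 1) * 2 ^ 82 *
        (Real.exp (-((9238 / 10000 * v * Real.log ((11 : ℝ) / 9) -
            Real.log (((278379899 : ℕ) : ℝ) / ((1000000 : ℕ) * (11 : ℕ) * (9 : ℕ)) / 2.604)) * n)) +
         Real.exp (-((13065 / 10000 * v * Real.log ((7 : ℝ) / 6) -
            Real.log (((118862805 : ℕ) : ℝ) / ((1000000 : ℕ) * (7 : ℕ) * (6 : ℕ)) / 2.604)) * n))) *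
        Zd.count 2 n := by
  have hμ : (2.604 : ℝ) ≤ Zd.connectiveConstant 2 := by
    rw [Zd.connectiveConstant_two]; exact le_connectiveConstant_2604
  have h := card_maxDisplacementEvent_le_of_checkW_checkD checkW_16_11_9 (by norm_num) (by norm_num)
    (by norm_num) (by norm_num) checkD_16_7_6 (by norm_num) (by norm_num) (by norm_num) (by norm_num)
    (by norm_num : (0 : ℝ) < 2.604) hμ hv n
  push_cast at h ⊢
  exact h

end Literature.Probability.RandomPlanarGeometry.SAW
namespace Literature.Probability.RandomPlanarGeometry.SAW

open FiniteMemory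

/-! ### The printed shape: `∃ ε > 0, ∃ n₀, ∀ n ≥ n₀, P ≤ e^{-εn}` above an explicit threshold -/

/-- Absorbing the polynomial prefactor: for rates `ε₁, ε₂ > 0` there are `ε > 0` and `n₀` with
`4(n+1)·2⁸²·(e^{-ε₁n} + e^{-ε₂n}) ≤ e^{-εn}` for all `n ≥ n₀` (`ε = min(ε₁,ε₂)/2`,
`n₀ = ⌈2⁸⁸/ε²⌉ + 1` works). [folklore] -/
private theorem absorb_prefactor {ε₁ ε₂ : ℝ} (h₁ : 0 < ε₁) (h₂ : 0 < ε₂) :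
    ∃ ε : ℝ, 0 < ε ∧ ∃ n₀ : ℕ, ∀ n : ℕ, n₀ ≤ n →
      4 * ((n : ℝ) + 1) * 2 ^ 82 * (Real.exp (-(ε₁ * n)) + Real.exp (-(ε₂ * n))) ≤ Real.exp (-(ε / 1 * n)) := by
  set e : ℝ := min ε₁ ε₂ / 2 with he
  have he0 : 0 < e := by rw [he]; exact div_pos (lt_min h₁ h₂) two_pos
  have he1 : 2 * e ≤ ε₁ := by rw [he]; linarith [min_le_left ε₁ ε₂]
  have he2 : 2 * e ≤ ε₂ := by rw [he]; linarith [min_le_right ε₁ ε₂]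
  refine ⟨e, he0, Nat.ceil (2 ^ 88 / e ^ 2) + 1, fun n hn => ?_⟩
  have hn1 : (1 : ℝ) ≤ n := by exact_mod_cast (show 1 ≤ n by omega)
  have hnbig : 2 ^ 88 / e ^ 2 ≤ (n : ℝ) := by
    have := Nat.le_ceil (2 ^ 88 / e ^ 2)
    have h' : ((Nat.ceil (2 ^ 88 / e ^ 2) : ℕ) : ℝ) + 1 ≤ n := by exact_mod_cast hn
    linarith
  -- `e^{-ε_i n} ≤ e^{-2en}` and `2⁸⁵ (n+1) e^{-2en} ≤ e^{-en}` since `2⁸⁵(n+1) ≤ (en)²/2 ≤ e^{en}`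
  have hx1 : Real.exp (-(ε₁ * n)) ≤ Real.exp (-(2 * e * n)) := Real.exp_le_exp.2 (by nlinarith)
  have hx2 : Real.exp (-(ε₂ * n)) ≤ Real.exp (-(2 * e * n)) := Real.exp_le_exp.2 (by nlinarith)
  have hq : (e * n) ^ 2 / 2 ≤ Real.exp (e * n) := by
    have := Real.quadratic_le_exp_of_nonneg (show 0 ≤ e * n by positivity)
    nlinarith [Real.exp_nonneg (e * n), show 0 ≤ e * n by positivity]
  have hpoly : 2 ^ 85 * ((n : ℝ) + 1) ≤ (e * n) ^ 2 / 2 := by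
    -- from `2⁸⁸/e² ≤ n`: `e² n ≥ 2⁸⁸`, so `(e n)²/2 = e² n · n /2 ≥ 2⁸⁷ n ≥ 2⁸⁵ (n+1)`
    have he2pos : 0 < e ^ 2 := by positivity
    have h1 : 2 ^ 88 ≤ e ^ 2 * n := by
      have := mul_le_mul_of_nonneg_left hnbig he2pos.le
      rwa [mul_div_cancel₀ _ he2pos.ne'] at this
    nlinarith
  have hfin : 2 ^ 85 * ((n : ℝ) + 1) * Real.exp (-(2 * e * n)) ≤ Real.exp (-(e * n)) := by
    have hexp : Real.exp (-(2 * e * n)) = Real.exp (-(e * n)) * (Real.exp (e * n))⁻¹ := by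
      rw [← Real.exp_neg, ← Real.exp_add]; congr 1; ring
    rw [hexp, ← mul_assoc]
    have hpos : 0 < Real.exp (e * n) := Real.exp_pos _
    rw [mul_inv_le_iff₀ hpos]
    calc 2 ^ 85 * ((n : ℝ) + 1) * Real.exp (-(e * n)) ≤ Real.exp (e * n) * Real.exp (-(e * n)) := by
          gcongr; exact le_trans hpoly hq
      _ = Real.exp (-(e * n)) * Real.exp (e * n) := mul_comm _ _
  calc 4 * ((n : ℝ) + 1) * 2 ^ 82 * (Real.exp (-(ε₁ * n)) + Real.exp (-(ε₂ * n)))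
      ≤ 4 * ((n : ℝ) + 1) * 2 ^ 82 * (Real.exp (-(2 * e * n)) + Real.exp (-(2 * e * n))) := by gcongr
    _ = 2 ^ 85 * ((n : ℝ) + 1) * Real.exp (-(2 * e * n)) := by ring
    _ ≤ Real.exp (-(e * n)) := hfin
    _ = Real.exp (-(e / 1 * n)) := by rw [div_one]

/-- **The certified threshold speed of the eight-direction scheme**:
`v₁ = max( log(λ̄₁/2.604)/(0.9238·log(11/9)), log(λ̄₂/2.604)/(1.3065·log(7/6)) ) = 0.41438…`
(`λ̄₁ = 2.811918…` axis tilt `11/9`, `λ̄₂ = 2.830067…` diagonal tilt `7/6`). [cite: DuminilCopinHammond2013, Thm 1.1] -/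
noncomputable def speedThreshold8 : ℝ :=
  max (Real.log (((278379899 : ℕ) : ℝ) / ((1000000 : ℕ) * (11 : ℕ) * (9 : ℕ)) / 2.604) /
        (9238 / 10000 * Real.log ((11 : ℝ) / 9)))
      (Real.log (((118862805 : ℕ) : ℝ) / ((1000000 : ℕ) * (7 : ℕ) * (6 : ℕ)) / 2.604) /
        (13065 / 10000 * Real.log ((7 : ℝ) / 6)))

/-- **Duminil-Copin–Hammond, Theorem 1.1, for `ℤ²` and every speed `v > v₁ = 0.4144`, in the printed
shape with explicit data**: there are `ε > 0` and `n₀` (constructed in the proof: `ε = min(ε₁,ε₂)/2`,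
`n₀ = ⌈2⁸⁸/ε²⌉+1`) such that `#{γ ∈ SAW_n : max_k ‖γ_k‖ ≥ vn} / cₙ ≤ e^{-εn}` for all `n ≥ n₀`.
[cite: DuminilCopinHammond2013, Thm 1.1] -/
theorem dch_thm11_two_explicit {v : ℝ} (hv : speedThreshold8 < v) :
    ∃ ε : ℝ, 0 < ε ∧ ∃ n₀ : ℕ, ∀ n : ℕ, n₀ ≤ n →
      ((Zd.maxDisplacementEvent 2 n v).card : ℝ) / (Zd.count 2 n : ℝ) ≤ Real.exp (-(ε * n)) := by
  have hl1 : 0 < Real.log ((11 : ℝ) / 9) := Real.log_pos (by norm_num)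
  have hl2 : 0 < Real.log ((7 : ℝ) / 6) := Real.log_pos (by norm_num)
  have hv1 : Real.log (((278379899 : ℕ) : ℝ) / ((1000000 : ℕ) * (11 : ℕ) * (9 : ℕ)) / 2.604) /
      (9238 / 10000 * Real.log ((11 : ℝ) / 9)) < v := lt_of_le_of_lt (le_max_left _ _) hv
  have hv2 : Real.log (((118862805 : ℕ) : ℝ) / ((1000000 : ℕ) * (7 : ℕ) * (6 : ℕ)) / 2.604) /
      (13065 / 10000 * Real.log ((7 : ℝ) / 6)) < v := lt_of_le_of_lt (le_max_right _ _) hv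
  have hv0 : 0 ≤ v := by
    -- `v₁ ≥ 0` because `λ̄₁ ≥ 2.604`
    have : 0 ≤ Real.log (((278379899 : ℕ) : ℝ) / ((1000000 : ℕ) * (11 : ℕ) * (9 : ℕ)) / 2.604) /
        (9238 / 10000 * Real.log ((11 : ℝ) / 9)) :=
      div_nonneg (Real.log_nonneg (by norm_num)) (by positivity)
    linarith
  set ε₁ : ℝ := 9238 / 10000 * v * Real.log ((11 : ℝ) / 9) -
    Real.log (((278379899 : ℕ) : ℝ) / ((1000000 : ℕ) * (11 : ℕ) * (9 : ℕ)) / 2.604) with hε₁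
  set ε₂ : ℝ := 13065 / 10000 * v * Real.log ((7 : ℝ) / 6) -
    Real.log (((118862805 : ℕ) : ℝ) / ((1000000 : ℕ) * (7 : ℕ) * (6 : ℕ)) / 2.604) with hε₂
  have h1 : 0 < ε₁ := by
    rw [hε₁]; rw [div_lt_iff₀ (by positivity)] at hv1; linarith
  have h2 : 0 < ε₂ := by
    rw [hε₂]; rw [div_lt_iff₀ (by positivity)] at hv2; linarith
  obtain ⟨ε, hε, n₀, hn₀⟩ := absorb_prefactor h1 h2
  refine ⟨ε, hε, n₀ + 1, fun n hn => ?_⟩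
  have hc : (0 : ℝ) < Zd.count 2 n := by
    have := Zd.pow_connectiveConstant_le_count 2 n
    exact lt_of_lt_of_le (pow_pos (Zd.connectiveConstant_pos 2) n) this
  rw [div_le_iff₀ hc]
  have hmain := card_maxDisplacementEvent_le_exp8 hv0 n
  have hab := hn₀ n (by omega)
  rw [div_one] at hab
  calc ((Zd.maxDisplacementEvent 2 n v).card : ℝ)
      ≤ 4 * (n + 1) * 2 ^ 82 * (Real.exp (-(ε₁ * n)) + Real.exp (-(ε₂ * n))) * Zd.count 2 n := by
        simpa [hε₁, hε₂] using hmain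
    _ ≤ Real.exp (-(ε * n)) * Zd.count 2 n := by gcongr

end Literature.Probability.RandomPlanarGeometry.SAW
namespace Literature.Probability.RandomPlanarGeometry.SAW

open FiniteMemory

/-! ### The same theorem from any certified lower bound `μlo ≤ μ(ℤ²)`; the printed `μ ≥ 2.625622` -/

/-- The eight-direction threshold speed as a function of the lower bound `μlo` used for `μ(ℤ²)`:
`v₁(μlo) = max( log(λ̄₁/μlo)/(0.9238·log(11/9)), log(λ̄₂/μlo)/(1.3065·log(7/6)) )`
(`λ̄₁ = 278379899/(10⁶·99)`, `λ̄₂ = 118862805/(10⁶·42)`); `v₁(2.604) = speedThreshold8 = 0.4144…`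
and, with the printed `μ ≥ 2.625622` (Jensen 2004), `v₁(2.625622) = 0.3723…`.
[cite: DuminilCopinHammond2013, Thm 1.1] -/
noncomputable def speedThreshold8Of (μlo : ℝ) : ℝ :=
  max (Real.log (((278379899 : ℕ) : ℝ) / ((1000000 : ℕ) * (11 : ℕ) * (9 : ℕ)) / μlo) /
        (9238 / 10000 * Real.log ((11 : ℝ) / 9)))
      (Real.log (((118862805 : ℕ) : ℝ) / ((1000000 : ℕ) * (7 : ℕ) * (6 : ℕ)) / μlo) /
        (13065 / 10000 * Real.log ((7 : ℝ) / 6)))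

/-- `v₁(2.604)` is the threshold `speedThreshold8` of `dch_thm11_two_explicit`.
[cite: DuminilCopinHammond2013, Thm 1.1] -/
theorem speedThreshold8Of_eq : speedThreshold8Of 2.604 = speedThreshold8 := rfl

/-- **The all-`n` bound from ANY certified lower bound `0 < μlo ≤ μ(ℤ²)`** (axis tilt `11/9`,
diagonal tilt `7/6`, memory 16): for all `v ≥ 0` and `n`,
`#(maxDisplacementEvent 2 n v) ≤ 4(n+1)·2⁸²·(e^{-ε₁ n} + e^{-ε₂ n})·cₙ` with
`ε₁ = 0.9238 v log(11/9) - log(λ̄₁/μlo)`, `ε₂ = 1.3065 v log(7/6) - log(λ̄₂/μlo)`.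
[cite: DuminilCopinHammond2013, Thm 1.1] -/
theorem card_maxDisplacementEvent_le_exp8_of_le {μlo : ℝ} (hμ0 : 0 < μlo)
    (hμ : μlo ≤ Zd.connectiveConstant 2) {v : ℝ} (hv : 0 ≤ v) (n : ℕ) :
    ((Zd.maxDisplacementEvent 2 n v).card : ℝ) ≤
      4 * (n + 1) * 2 ^ 82 *
        (Real.exp (-((9238 / 10000 * v * Real.log ((11 : ℝ) / 9) -
            Real.log (((278379899 : ℕ) : ℝ) / ((1000000 : ℕ) * (11 : ℕ) * (9 : ℕ)) / μlo)) * n)) +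
         Real.exp (-((13065 / 10000 * v * Real.log ((7 : ℝ) / 6) -
            Real.log (((118862805 : ℕ) : ℝ) / ((1000000 : ℕ) * (7 : ℕ) * (6 : ℕ)) / μlo)) * n))) *
        Zd.count 2 n := by
  have h := card_maxDisplacementEvent_le_of_checkW_checkD checkW_16_11_9 (by norm_num) (by norm_num)
    (by norm_num) (by norm_num) checkD_16_7_6 (by norm_num) (by norm_num) (by norm_num) (by norm_num)
    hμ0 hμ hv n
  push_cast at h ⊢
  exact h

/-- **Duminil-Copin–Hammond, Theorem 1.1, on `ℤ²` above the threshold `v₁(μlo)` of ANY certified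
lower bound `0 < μlo ≤ μ(ℤ²)`**, printed shape: for every `v > v₁(μlo)` there are `ε > 0` and `n₀`
(`ε = min(ε₁,ε₂)/2`, `n₀ = ⌈2⁸⁸/ε²⌉ + 2`) with `#{γ ∈ SAW_n : max_k ‖γ_k‖ ≥ vn}/cₙ ≤ e^{-εn}` for
all `n ≥ n₀`. (`v₁(μlo) ≥ 0` automatically, because `μlo ≤ μ ≤ 2.689 < λ̄₁`.)
[cite: DuminilCopinHammond2013, Thm 1.1] -/
theorem dch_thm11_two_explicit_of_le {μlo : ℝ} (hμ0 : 0 < μlo)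
    (hμ : μlo ≤ Zd.connectiveConstant 2) {v : ℝ} (hv : speedThreshold8Of μlo < v) :
    ∃ ε : ℝ, 0 < ε ∧ ∃ n₀ : ℕ, ∀ n : ℕ, n₀ ≤ n →
      ((Zd.maxDisplacementEvent 2 n v).card : ℝ) / (Zd.count 2 n : ℝ) ≤ Real.exp (-(ε * n)) := by
  have hl1 : 0 < Real.log ((11 : ℝ) / 9) := Real.log_pos (by norm_num)
  have hl2 : 0 < Real.log ((7 : ℝ) / 6) := Real.log_pos (by norm_num)
  have hv1 : Real.log (((278379899 : ℕ) : ℝ) / ((1000000 : ℕ) * (11 : ℕ) * (9 : ℕ)) / μlo) /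
      (9238 / 10000 * Real.log ((11 : ℝ) / 9)) < v := lt_of_le_of_lt (le_max_left _ _) hv
  have hv2 : Real.log (((118862805 : ℕ) : ℝ) / ((1000000 : ℕ) * (7 : ℕ) * (6 : ℕ)) / μlo) /
      (13065 / 10000 * Real.log ((7 : ℝ) / 6)) < v := lt_of_le_of_lt (le_max_right _ _) hv
  have hμup : μlo ≤ 2.689 := by
    have h' : Zd.connectiveConstant 2 ≤ 2.689 := by
      rw [Zd.connectiveConstant_two]; exact connectiveConstant_le_2689
    exact le_trans hμ h'
  have hv0 : 0 ≤ v := by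
    -- `v₁(μlo) ≥ 0` because `λ̄₁/μlo ≥ λ̄₁/2.689 > 1`
    have hq : (1 : ℝ) ≤ ((278379899 : ℕ) : ℝ) / ((1000000 : ℕ) * (11 : ℕ) * (9 : ℕ)) / μlo := by
      rw [le_div_iff₀ hμ0]; push_cast; linarith
    have : 0 ≤ Real.log (((278379899 : ℕ) : ℝ) / ((1000000 : ℕ) * (11 : ℕ) * (9 : ℕ)) / μlo) /
        (9238 / 10000 * Real.log ((11 : ℝ) / 9)) :=
      div_nonneg (Real.log_nonneg hq) (by positivity)
    linarith
  set ε₁ : ℝ := 9238 / 10000 * v * Real.log ((11 : ℝ) / 9) -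
    Real.log (((278379899 : ℕ) : ℝ) / ((1000000 : ℕ) * (11 : ℕ) * (9 : ℕ)) / μlo) with hε₁
  set ε₂ : ℝ := 13065 / 10000 * v * Real.log ((7 : ℝ) / 6) -
    Real.log (((118862805 : ℕ) : ℝ) / ((1000000 : ℕ) * (7 : ℕ) * (6 : ℕ)) / μlo) with hε₂
  have h1 : 0 < ε₁ := by
    rw [hε₁]; rw [div_lt_iff₀ (by positivity)] at hv1; linarith
  have h2 : 0 < ε₂ := by
    rw [hε₂]; rw [div_lt_iff₀ (by positivity)] at hv2; linarith
  obtain ⟨ε, hε, n₀, hn₀⟩ := absorb_prefactor h1 h2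
  refine ⟨ε, hε, n₀ + 1, fun n hn => ?_⟩
  have hc : (0 : ℝ) < Zd.count 2 n := by
    have := Zd.pow_connectiveConstant_le_count 2 n
    exact lt_of_lt_of_le (pow_pos (Zd.connectiveConstant_pos 2) n) this
  rw [div_le_iff₀ hc]
  have hmain := card_maxDisplacementEvent_le_exp8_of_le hμ0 hμ hv0 n
  have hab := hn₀ n (by omega)
  rw [div_one] at hab
  calc ((Zd.maxDisplacementEvent 2 n v).card : ℝ)
      ≤ 4 * (n + 1) * 2 ^ 82 * (Real.exp (-(ε₁ * n)) + Real.exp (-(ε₂ * n))) * Zd.count 2 n := by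
        simpa [hε₁, hε₂] using hmain
    _ ≤ Real.exp (-(ε * n)) * Zd.count 2 n := by gcongr

/-- **The printed-record variant of Theorem 1.1 on `ℤ²`**: assuming the printed enclosure
`μ(ℤ²) ≥ 2.625622` (`Zd.BDGS2012_connectiveConstant_two_bounds`; the lower bound is Jensen 2004),
for every `v > v₁(2.625622) = 0.3723…` there are `ε > 0`, `n₀` with
`#{γ ∈ SAW_n : max_k ‖γ_k‖ ≥ vn}/cₙ ≤ e^{-εn}` for all `n ≥ n₀`.
[cite: DuminilCopinHammond2013, Thm 1.1] -/
theorem dch_thm11_two_explicit_of_printed (hJ : Zd.BDGS2012_connectiveConstant_two_bounds)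
    {v : ℝ} (hv : speedThreshold8Of 2.625622 < v) :
    ∃ ε : ℝ, 0 < ε ∧ ∃ n₀ : ℕ, ∀ n : ℕ, n₀ ≤ n →
      ((Zd.maxDisplacementEvent 2 n v).card : ℝ) / (Zd.count 2 n : ℝ) ≤ Real.exp (-(ε * n)) :=
  dch_thm11_two_explicit_of_le (by norm_num) hJ.1 hv

end Literature.Probability.RandomPlanarGeometry.SAW
namespace Literature.Probability.RandomPlanarGeometry.SAW

/-! ### Certified decimal enclosures of the two thresholds: `v₁(2.604) < 0.415`, `v₁(2.625622) < 0.3725` -/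

/-- Series upper bound for `-log(1-x)`, `0 ≤ x < 1`:
`-log(1-x) ≤ ∑_{i<N} x^{i+1}/(i+1) + x^{N+1}/(1-x)`. [folklore] -/
private theorem neg_log_one_sub_le {x : ℝ} (hx0 : 0 ≤ x) (hx1 : x < 1) (N : ℕ) :
    -Real.log (1 - x) ≤ (∑ i ∈ Finset.range N, x ^ (i + 1) / (i + 1)) + x ^ (N + 1) / (1 - x) := by
  have h := Real.abs_log_sub_add_sum_range_le (show |x| < 1 by rwa [abs_of_nonneg hx0]) N
  rw [abs_of_nonneg hx0] at h
  linarith [(abs_le.1 h).1]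

/-- Series lower bound for `-log(1-x)`, `0 ≤ x < 1`:
`∑_{i<N} x^{i+1}/(i+1) - x^{N+1}/(1-x) ≤ -log(1-x)`. [folklore] -/
private theorem le_neg_log_one_sub {x : ℝ} (hx0 : 0 ≤ x) (hx1 : x < 1) (N : ℕ) :
    (∑ i ∈ Finset.range N, x ^ (i + 1) / (i + 1)) - x ^ (N + 1) / (1 - x) ≤ -Real.log (1 - x) := by
  have h := Real.abs_log_sub_add_sum_range_le (show |x| < 1 by rwa [abs_of_nonneg hx0]) N
  rw [abs_of_nonneg hx0] at h
  linarith [(abs_le.1 h).2]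

/-- Series upper bound for `log R`, `R ≥ 1` (the previous lemma at `x = 1 - 1/R`):
`log R ≤ ∑_{i<N} (1-1/R)^{i+1}/(i+1) + (1-1/R)^{N+1}·R`. [folklore] -/
private theorem log_le_series {R : ℝ} (hR : 1 ≤ R) (N : ℕ) :
    Real.log R ≤ (∑ i ∈ Finset.range N, (1 - R⁻¹) ^ (i + 1) / (i + 1)) + (1 - R⁻¹) ^ (N + 1) * R := by
  have hR0 : 0 < R := by linarith
  have hx0 : 0 ≤ 1 - R⁻¹ := by rw [sub_nonneg]; exact inv_le_one_of_one_le₀ hR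
  have hx1 : 1 - R⁻¹ < 1 := by have := inv_pos.2 hR0; linarith
  have h := neg_log_one_sub_le hx0 hx1 N
  rwa [show (1 : ℝ) - (1 - R⁻¹) = R⁻¹ by ring, Real.log_inv, neg_neg, div_inv_eq_mul] at h

/-- `log(11/9) > 0.2006` (`= 0.20067…`). [folklore] -/
private theorem log_eleven_div_nine_gt : (0.2006 : ℝ) < Real.log ((11 : ℝ) / 9) := by
  have h := le_neg_log_one_sub (x := 2 / 11) (by norm_num) (by norm_num) 5
  rw [show (1 : ℝ) - 2 / 11 = ((11 : ℝ) / 9)⁻¹ by norm_num, Real.log_inv, neg_neg] at h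
  refine lt_of_lt_of_le ?_ h
  norm_num [Finset.sum_range_succ]

/-- `log(7/6) > 0.15414` (`= 0.154150…`). [folklore] -/
private theorem log_seven_div_six_gt : (0.15414 : ℝ) < Real.log ((7 : ℝ) / 6) := by
  have h := le_neg_log_one_sub (x := 1 / 7) (by norm_num) (by norm_num) 6
  rw [show (1 : ℝ) - 1 / 7 = ((7 : ℝ) / 6)⁻¹ by norm_num, Real.log_inv, neg_neg] at h
  refine lt_of_lt_of_le ?_ h
  norm_num [Finset.sum_range_succ]

/-- **`speedThreshold8 < 0.415`** (its value is `0.41438…`): the eight-direction theorem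
`dch_thm11_two_explicit` covers every speed `v ≥ 0.415`. [cite: DuminilCopinHammond2013, Thm 1.1] -/
theorem speedThreshold8_lt : speedThreshold8 < 0.415 := by
  have hl1 := log_eleven_div_nine_gt
  have hl2 := log_seven_div_six_gt
  have hp1 : (0 : ℝ) < 9238 / 10000 * Real.log ((11 : ℝ) / 9) := by linarith
  have hp2 : (0 : ℝ) < 13065 / 10000 * Real.log ((7 : ℝ) / 6) := by linarith
  refine max_lt ?_ ?_
  · rw [div_lt_iff₀ hp1]
    have hu := log_le_series
      (R := ((278379899 : ℕ) : ℝ) / ((1000000 : ℕ) * (11 : ℕ) * (9 : ℕ)) / 2.604) (by norm_num) 4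
    have hu' : Real.log (((278379899 : ℕ) : ℝ) / ((1000000 : ℕ) * (11 : ℕ) * (9 : ℕ)) / 2.604) ≤
        0.076821 := le_trans hu (by norm_num [Finset.sum_range_succ])
    have hc : (0.076821 : ℝ) < 0.415 * (9238 / 10000 * 0.2006) := by norm_num
    nlinarith
  · rw [div_lt_iff₀ hp2]
    have hu := log_le_series
      (R := ((118862805 : ℕ) : ℝ) / ((1000000 : ℕ) * (7 : ℕ) * (6 : ℕ)) / 2.604) (by norm_num) 4
    have hu' : Real.log (((118862805 : ℕ) : ℝ) / ((1000000 : ℕ) * (7 : ℕ) * (6 : ℕ)) / 2.604) ≤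
        0.083255 := le_trans hu (by norm_num [Finset.sum_range_succ])
    have hc : (0.083255 : ℝ) < 0.415 * (13065 / 10000 * 0.15414) := by norm_num
    nlinarith

/-- **`speedThreshold8Of 2.625622 < 0.3725`** (its value is `0.37231…`): with the printed
`μ ≥ 2.625622`, `dch_thm11_two_explicit_of_printed` covers every speed `v ≥ 0.3725`.
[cite: DuminilCopinHammond2013, Thm 1.1] -/
theorem speedThreshold8Of_printed_lt : speedThreshold8Of 2.625622 < 0.3725 := by
  have hl1 := log_eleven_div_nine_gt
  have hl2 := log_seven_div_six_gt
  have hp1 : (0 : ℝ) < 9238 / 10000 * Real.log ((11 : ℝ) / 9) := by linarith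
  have hp2 : (0 : ℝ) < 13065 / 10000 * Real.log ((7 : ℝ) / 6) := by linarith
  refine max_lt ?_ ?_
  · rw [div_lt_iff₀ hp1]
    have hu := log_le_series
      (R := ((278379899 : ℕ) : ℝ) / ((1000000 : ℕ) * (11 : ℕ) * (9 : ℕ)) / 2.625622) (by norm_num) 4
    have hu' : Real.log (((278379899 : ℕ) : ℝ) / ((1000000 : ℕ) * (11 : ℕ) * (9 : ℕ)) / 2.625622) ≤
        0.068551 := le_trans hu (by norm_num [Finset.sum_range_succ])
    have hc : (0.068551 : ℝ) < 0.3725 * (9238 / 10000 * 0.2006) := by norm_num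
    nlinarith
  · rw [div_lt_iff₀ hp2]
    have hu := log_le_series
      (R := ((118862805 : ℕ) : ℝ) / ((1000000 : ℕ) * (7 : ℕ) * (6 : ℕ)) / 2.625622) (by norm_num) 4
    have hu' : Real.log (((118862805 : ℕ) : ℝ) / ((1000000 : ℕ) * (7 : ℕ) * (6 : ℕ)) / 2.625622) ≤
        0.074985 := le_trans hu (by norm_num [Finset.sum_range_succ])
    have hc : (0.074985 : ℝ) < 0.3725 * (13065 / 10000 * 0.15414) := by norm_num
    nlinarith

end Literature.Probability.RandomPlanarGeometry.SAW
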